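import Summits.QuantumFields.BalabanUV.Beta.RelInvCombBorderedKKT

/-!
# `BalabanUV.Beta.RelInvCombBorderedKKTGram` — binder row D1: the comb-bordered KKT bridge of `RelInvCombBorderedKKT` for a
# NON-COORDINATE comb (Gram form `E = 1 − T·(TᵀT)⁻¹·Tᵀ`), e.g. the NESTED combs `[τ₁ᵀ, Q₁ᵀτ₂ᵀ]` of composite averaging steps
# (β sub-cell, BINDER-OWNERS row D1 OWNER, lineage an2 gen 23; sequel of K-U1 p236069)

HONEST FRAMING (cell charter, verbatim): «discharging BetaPertH makes Balaban's UV stability UNCONDITIONAL — a real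
constructive-QFT result; it is NOT the continuum limit and NOT the Clay problem.»
HONEST DEPENDENCY: continuum YM on T⁴ ⇐ BetaPertH ∧ nine spine estimates (0/9 proved); BetaPertH ⇐ (D1) ∧ (D4) ∧ CAP+tail;
G-an2-4 gates asym, D1 and NE2/3/4.
ABSOLUTE RULE (cell, verbatim): «No internally-minted statement may enter as a cited fact. Every hypothesis is either kernel-proved in this
package or a verbatim quotation of a PUBLISHED theorem with page reference. The manuscript(s) under audit are NOT citable for their own
disputed steps — they are the thing under adjudication; programme-internal (2001/route/tribunal) claims are never citable.»
NOTHING below is cited: no `[cite: …]`, no `def`, no `Prop` fact.  Every declaration is [folklore] linear algebra over a field (Mathlib block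
matrices + `Composition.kkt`, `CompositionSingular.flucCov ∕ minOp ∕ minOpL ∕ effForm`, and K-U1's `transpose_fromRows_mul_fromRows` ∕
`kkt_fromRows_submatrix_sumAssoc` BY NAME).  It asserts nothing about Bałaban's objects.

WHY (row-D1 owner, gen 23).  K-U1 (`RelInvCombBorderedKKT`, p236069) bridges the four relative-inverse rules `E·A = A = A·E`, `A·𝕄·E = E = E·𝕄·A`
and the comb-bordered matrix `[[𝕄, T],[Tᵀ, 0]]` for a COORDINATE complement (`Tᵀ·T = 1`) — the shape of ONE averaging step's axial comb (`axEc`).  The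
COMPOSITE of two steps (route (O1)'s comparison family `JcComp`, RULING R-D1-g23-1; `SliceComposition`'s nested constraint
`fromRows (fromRows (Q₂Q₁) (τ₂Q₁)) τ₁`) carries the NESTED comb `[τ₁; τ₂Q₁]`, whose rows are NOT coordinate vectors and not orthonormal: the natural `E` is
the orthogonal projector `1 − T(TᵀT)⁻¹Tᵀ` onto the joint kernel.  THIS FILE redoes K-U1 in that GRAM form: same four rules, explicit bordered inverse
`[[A, (T − A𝕄T)R⁻¹],[R⁻¹(Tᵀ − Tᵀ𝕄A), R⁻¹(Tᵀ𝕄A𝕄T − Tᵀ𝕄T)R⁻¹]]` (`R := TᵀT`), converse, and the `kkt K (fromRows Q τ)` form for ANY comb `τ` with `τ·τᵀ`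
invertible.  With `R = 1` every statement specialises to K-U1.

WHAT (all [folklore]):
§1 GRAM FORM, GENERIC (`M A E : Matrix α α 𝕜`, `T : Matrix α γ 𝕜`, `IsUnit (Tᵀ·T).det`, `E = 1 − T(TᵀT)⁻¹Tᵀ`): `E_mul_T_gram`, `Tt_mul_E_gram`,
   **`combBordered_mul_gram`** (right inverse from ONLY `E·A = A`, `E·𝕄·A = E`), **`mul_combBordered_gram`** (left inverse from ONLY `A·E = A`, `A·𝕄·E = E`),
   `isUnit_det_combBordered_gram`, **`inv_combBordered_gram`**, `toBlocks₁₁_inv_combBordered_gram`, **`relInv_of_isUnit_det_combBordered_gram`** (CONVERSE).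
§2 KKT FORM, GENERAL COMB (`K : Matrix ν ν 𝕜`, `Q : Matrix μ ν 𝕜`, `τ : Matrix ρ ν 𝕜`, `IsUnit (τ·τᵀ).det`; `E := fromBlocks (1 − τᵀ(ττᵀ)⁻¹τ) 0 0 1`):
   `one_sub_fromRows_gram_transpose`, **`isUnit_det_kkt_fromRows_of_relInv_gram`**, **`blocks_kkt_fromRows_of_relInv_gram`** (`flucCov K (fromRows Q τ) = A₁₁`,
   `(minOp …).toCols₁ = A₁₂`, `(minOpL …).toRows₁ = A₂₁`, `(effForm …).toBlocks₁₁ = −A₂₂`), **`relInv_blocks_kkt_fromRows_gram`** (CONVERSE).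
Provenance: β sub-cell, unit beta-an2 gen 23 (prover-b2b-balaban-beta-an2-g23-0), 2026-08-20.  NOT D1Rep, NOT D1, NOT `BetaPertH`, NOT continuum, NOT Clay.
-/

namespace Summit.QuantumFields.BalabanUV.Beta.RelInvCombBorderedKKTGram

open scoped Matrix
open Matrix
open Literature.MathematicalPhysics.QuantumFieldTheory.Balaban1983to89.Beta.Composition (kkt)
open Literature.MathematicalPhysics.QuantumFieldTheory.Balaban1983to89.Beta.CompositionSingular (flucCov minOp minOpL effForm)
open Summit.QuantumFields.BalabanUV.Beta.RelInvCombBorderedKKT (transpose_fromRows_mul_fromRows kkt_fromRows_submatrix_sumAssoc)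

variable {𝕜 : Type*} [Field 𝕜]

/-! ## §1 The Gram form: a non-coordinate complement `T` with `Tᵀ·T` invertible, `E = 1 − T·(TᵀT)⁻¹·Tᵀ` -/

section Gram

variable {α γ : Type*} [Fintype α] [Fintype γ] [DecidableEq α] [DecidableEq γ]
variable {M A E : Matrix α α 𝕜} {T : Matrix α γ 𝕜}

/-- [folklore] `E·T = 0` for `E = 1 − T·R⁻¹·Tᵀ`, `R = Tᵀ·T` invertible. -/
theorem E_mul_T_gram (hR : IsUnit (Tᵀ * T).det) (hE : E = 1 - T * (Tᵀ * T)⁻¹ * Tᵀ) : E * T = 0 := by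
  rw [hE, Matrix.sub_mul, Matrix.one_mul, Matrix.mul_assoc, Matrix.mul_assoc, Matrix.nonsing_inv_mul _ hR, Matrix.mul_one,
    sub_self]

/-- [folklore] `Tᵀ·E = 0` for `E = 1 − T·R⁻¹·Tᵀ`. -/
theorem Tt_mul_E_gram (hR : IsUnit (Tᵀ * T).det) (hE : E = 1 - T * (Tᵀ * T)⁻¹ * Tᵀ) : Tᵀ * E = 0 := by
  rw [hE, Matrix.mul_sub, Matrix.mul_one, show Tᵀ * (T * (Tᵀ * T)⁻¹ * Tᵀ) = Tᵀ * T * (Tᵀ * T)⁻¹ * Tᵀ by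
    simp only [Matrix.mul_assoc], Matrix.mul_nonsing_inv _ hR, Matrix.one_mul, sub_self]

/-- [folklore] **GRAM FORM, RIGHT INVERSE** — from ONLY `E·A = A`, `E·𝕄·A = E` (`R := TᵀT` invertible, `E = 1 − T R⁻¹ Tᵀ`):
`[[𝕄, T],[Tᵀ, 0]] · [[A, (T − A𝕄T)R⁻¹],[R⁻¹(Tᵀ − Tᵀ𝕄A), R⁻¹(Tᵀ𝕄A𝕄T − Tᵀ𝕄T)R⁻¹]] = 1`. -/
theorem combBordered_mul_gram (hR : IsUnit (Tᵀ * T).det) (hE : E = 1 - T * (Tᵀ * T)⁻¹ * Tᵀ) (hEA : E * A = A)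
    (hEMA : E * M * A = E) :
    fromBlocks M T Tᵀ (0 : Matrix γ γ 𝕜) *
        fromBlocks A ((T - A * M * T) * (Tᵀ * T)⁻¹) ((Tᵀ * T)⁻¹ * (Tᵀ - Tᵀ * M * A))
          ((Tᵀ * T)⁻¹ * (Tᵀ * M * A * M * T - Tᵀ * M * T) * (Tᵀ * T)⁻¹) = 1 := by
  set Ri := (Tᵀ * T)⁻¹ with hRi
  have hRRi : Tᵀ * T * Ri = 1 := Matrix.mul_nonsing_inv _ hR
  have hTE : Tᵀ * E = 0 := Tt_mul_E_gram hR hE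
  have hTA : Tᵀ * A = 0 := by rw [← hEA, ← Matrix.mul_assoc, hTE, Matrix.zero_mul]
  have hTT : T * Ri * Tᵀ = 1 - E := by rw [hE, sub_sub_cancel]
  rw [fromBlocks_multiply, ← fromBlocks_one]
  congr 1
  · -- `M·A + T·(R⁻¹(Tᵀ − Tᵀ𝕄A)) = 1`
    rw [show T * (Ri * (Tᵀ - Tᵀ * M * A)) = (T * Ri * Tᵀ) - (T * Ri * Tᵀ) * M * A by
      rw [Matrix.mul_sub]; simp only [Matrix.mul_assoc, Matrix.mul_sub], hTT, Matrix.sub_mul, Matrix.sub_mul, Matrix.one_mul, hEMA]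
    abel
  · -- `M·((T − A𝕄T)R⁻¹) + T·(R⁻¹(Tᵀ𝕄A𝕄T − Tᵀ𝕄T)R⁻¹) = 0`
    rw [show T * (Ri * (Tᵀ * M * A * M * T - Tᵀ * M * T) * Ri) = ((T * Ri * Tᵀ) * (M * A * M * T) - (T * Ri * Tᵀ) * (M * T)) * Ri by
      rw [Matrix.mul_sub]; simp only [Matrix.mul_assoc, Matrix.mul_sub, Matrix.sub_mul], hTT, ← Matrix.mul_assoc, ← Matrix.add_mul,
      Matrix.sub_mul, Matrix.sub_mul, Matrix.one_mul, Matrix.one_mul, Matrix.mul_sub,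
      show E * (M * A * M * T) = E * M * T by
        rw [show M * A * M * T = M * A * (M * T) by simp only [Matrix.mul_assoc], ← Matrix.mul_assoc,
          show E * (M * A) = E * M * A by rw [Matrix.mul_assoc], hEMA, Matrix.mul_assoc],
      show M * (A * M * T) = M * A * M * T by simp only [Matrix.mul_assoc],
      show E * (M * T) = E * M * T by rw [Matrix.mul_assoc]]
    rw [show M * T - M * A * M * T + (M * A * M * T - E * M * T - (M * T - E * M * T)) = 0 by abel, Matrix.zero_mul]
  · -- `Tᵀ·A + 0 = 0`
    rw [hTA, Matrix.zero_mul, add_zero]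
  · -- `Tᵀ·((T − A𝕄T)R⁻¹) + 0 = 1`
    rw [Matrix.zero_mul, add_zero, ← Matrix.mul_assoc, Matrix.mul_sub,
      show Tᵀ * (A * M * T) = Tᵀ * A * (M * T) by simp only [Matrix.mul_assoc], hTA, Matrix.zero_mul, sub_zero, hRRi]

/-- [folklore] **GRAM FORM, LEFT INVERSE** — from ONLY `A·E = A`, `A·𝕄·E = E`. -/
theorem mul_combBordered_gram (hR : IsUnit (Tᵀ * T).det) (hE : E = 1 - T * (Tᵀ * T)⁻¹ * Tᵀ) (hAE : A * E = A)
    (hAME : A * M * E = E) :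
    fromBlocks A ((T - A * M * T) * (Tᵀ * T)⁻¹) ((Tᵀ * T)⁻¹ * (Tᵀ - Tᵀ * M * A))
          ((Tᵀ * T)⁻¹ * (Tᵀ * M * A * M * T - Tᵀ * M * T) * (Tᵀ * T)⁻¹) *
        fromBlocks M T Tᵀ (0 : Matrix γ γ 𝕜) = 1 := by
  set Ri := (Tᵀ * T)⁻¹ with hRi
  have hRiR : Ri * (Tᵀ * T) = 1 := Matrix.nonsing_inv_mul _ hR
  have hET : E * T = 0 := E_mul_T_gram hR hE
  have hAT : A * T = 0 := by rw [← hAE, Matrix.mul_assoc, hET, Matrix.mul_zero]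
  have hTT : T * Ri * Tᵀ = 1 - E := by rw [hE, sub_sub_cancel]
  rw [fromBlocks_multiply, ← fromBlocks_one]
  congr 1
  · -- `A·M + (T − A𝕄T)R⁻¹·Tᵀ = 1`
    rw [Matrix.sub_mul, Matrix.sub_mul, show A * M * T * Ri * Tᵀ = A * M * (T * Ri * Tᵀ) by simp only [Matrix.mul_assoc], hTT,
      Matrix.mul_sub, Matrix.mul_one, hAME]
    abel
  · -- `A·T + ((T − A𝕄T)R⁻¹)·0 = 0`
    rw [hAT, Matrix.mul_zero, add_zero]
  · -- `(R⁻¹(Tᵀ − Tᵀ𝕄A))·M + (R⁻¹(Tᵀ𝕄A𝕄T − Tᵀ𝕄T)R⁻¹)·Tᵀ = 0`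
    rw [show Ri * (Tᵀ * M * A * M * T - Tᵀ * M * T) * Ri * Tᵀ = Ri * ((Tᵀ * M * A * M) * (T * Ri * Tᵀ) - (Tᵀ * M) * (T * Ri * Tᵀ)) by
      simp only [Matrix.mul_assoc, Matrix.mul_sub, Matrix.sub_mul], hTT, Matrix.mul_assoc Ri (Tᵀ - Tᵀ * M * A) M, ← Matrix.mul_add,
      Matrix.sub_mul, Matrix.mul_sub, Matrix.mul_sub, Matrix.mul_one, Matrix.mul_one,
      show Tᵀ * M * A * M * E = Tᵀ * M * (A * M * E) by simp only [Matrix.mul_assoc], hAME]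
    rw [show Tᵀ * M - Tᵀ * M * A * M + (Tᵀ * M * A * M - Tᵀ * M * E - (Tᵀ * M - Tᵀ * M * E)) = 0 by abel, Matrix.mul_zero]
  · -- `(R⁻¹(Tᵀ − Tᵀ𝕄A))·T + 0 = 1`
    rw [Matrix.mul_zero, add_zero, Matrix.mul_assoc, Matrix.sub_mul,
      show Tᵀ * M * A * T = Tᵀ * M * (A * T) by simp only [Matrix.mul_assoc], hAT, Matrix.mul_zero, sub_zero, hRiR]

/-- [folklore] Hence `[[𝕄, T],[Tᵀ, 0]]` is invertible (Gram form; from `E·A = A`, `E·𝕄·A = E`). -/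
theorem isUnit_det_combBordered_gram (hR : IsUnit (Tᵀ * T).det) (hE : E = 1 - T * (Tᵀ * T)⁻¹ * Tᵀ) (hEA : E * A = A)
    (hEMA : E * M * A = E) : IsUnit (fromBlocks M T Tᵀ (0 : Matrix γ γ 𝕜)).det :=
  isUnit_det_of_right_inverse (combBordered_mul_gram hR hE hEA hEMA)

/-- [folklore] **THE COMB-BORDERED INVERSE, GRAM FORM**:
`[[𝕄, T],[Tᵀ, 0]]⁻¹ = [[A, (T − A𝕄T)R⁻¹],[R⁻¹(Tᵀ − Tᵀ𝕄A), R⁻¹(Tᵀ𝕄A𝕄T − Tᵀ𝕄T)R⁻¹]]`. -/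
theorem inv_combBordered_gram (hR : IsUnit (Tᵀ * T).det) (hE : E = 1 - T * (Tᵀ * T)⁻¹ * Tᵀ) (hEA : E * A = A)
    (hEMA : E * M * A = E) :
    (fromBlocks M T Tᵀ (0 : Matrix γ γ 𝕜))⁻¹ =
      fromBlocks A ((T - A * M * T) * (Tᵀ * T)⁻¹) ((Tᵀ * T)⁻¹ * (Tᵀ - Tᵀ * M * A))
        ((Tᵀ * T)⁻¹ * (Tᵀ * M * A * M * T - Tᵀ * M * T) * (Tᵀ * T)⁻¹) :=
  inv_eq_right_inv (combBordered_mul_gram hR hE hEA hEMA)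

/-- [folklore] **THE `(ν ⊕ μ)`-CORNER OF THE COMB-BORDERED INVERSE IS `A`** (Gram form). -/
theorem toBlocks₁₁_inv_combBordered_gram (hR : IsUnit (Tᵀ * T).det) (hE : E = 1 - T * (Tᵀ * T)⁻¹ * Tᵀ) (hEA : E * A = A)
    (hEMA : E * M * A = E) : ((fromBlocks M T Tᵀ (0 : Matrix γ γ 𝕜))⁻¹).toBlocks₁₁ = A := by
  rw [inv_combBordered_gram hR hE hEA hEMA, toBlocks_fromBlocks₁₁]

/-- [folklore] **CONVERSE, GRAM FORM**: if `[[𝕄, T],[Tᵀ, 0]]` is invertible (`TᵀT` invertible, `E = 1 − T(TᵀT)⁻¹Tᵀ`), the `(ν ⊕ μ)`-corner `A` of its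
inverse satisfies `E·A = A`, `A·E = A`, `A·𝕄·E = E`, `E·𝕄·A = E`. -/
theorem relInv_of_isUnit_det_combBordered_gram (hR : IsUnit (Tᵀ * T).det) (hE : E = 1 - T * (Tᵀ * T)⁻¹ * Tᵀ)
    (h : IsUnit (fromBlocks M T Tᵀ (0 : Matrix γ γ 𝕜)).det) :
    E * ((fromBlocks M T Tᵀ (0 : Matrix γ γ 𝕜))⁻¹).toBlocks₁₁ = ((fromBlocks M T Tᵀ (0 : Matrix γ γ 𝕜))⁻¹).toBlocks₁₁ ∧
      ((fromBlocks M T Tᵀ (0 : Matrix γ γ 𝕜))⁻¹).toBlocks₁₁ * E = ((fromBlocks M T Tᵀ (0 : Matrix γ γ 𝕜))⁻¹).toBlocks₁₁ ∧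
        ((fromBlocks M T Tᵀ (0 : Matrix γ γ 𝕜))⁻¹).toBlocks₁₁ * M * E = E ∧
          E * M * ((fromBlocks M T Tᵀ (0 : Matrix γ γ 𝕜))⁻¹).toBlocks₁₁ = E := by
  set B := (fromBlocks M T Tᵀ (0 : Matrix γ γ 𝕜))⁻¹ with hB
  have hR : fromBlocks M T Tᵀ (0 : Matrix γ γ 𝕜) * B = 1 := Matrix.mul_nonsing_inv _ h
  have hL : B * fromBlocks M T Tᵀ (0 : Matrix γ γ 𝕜) = 1 := Matrix.nonsing_inv_mul _ h
  conv_lhs at hR => rw [← fromBlocks_toBlocks B]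
  conv_lhs at hL => rw [← fromBlocks_toBlocks B]
  rw [fromBlocks_multiply, ← fromBlocks_one, fromBlocks_inj] at hR hL
  obtain ⟨r11, -, r21, -⟩ := hR
  obtain ⟨l11, l12, -, -⟩ := hL
  rw [Matrix.zero_mul, add_zero] at r21
  rw [Matrix.mul_zero, add_zero] at l12
  have hEA : E * B.toBlocks₁₁ = B.toBlocks₁₁ := by
    rw [hE, Matrix.sub_mul, Matrix.one_mul, Matrix.mul_assoc, r21, Matrix.mul_zero, sub_zero]
  have hAE : B.toBlocks₁₁ * E = B.toBlocks₁₁ := by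
    rw [hE, Matrix.mul_sub, Matrix.mul_one, show B.toBlocks₁₁ * (T * (Tᵀ * T)⁻¹ * Tᵀ) = B.toBlocks₁₁ * T * ((Tᵀ * T)⁻¹ * Tᵀ) by
      simp only [Matrix.mul_assoc], l12, Matrix.zero_mul, sub_zero]
  refine ⟨hEA, hAE, ?_, ?_⟩
  · have e : B.toBlocks₁₁ * M = 1 - B.toBlocks₁₂ * Tᵀ := eq_sub_of_add_eq l11
    rw [e, Matrix.sub_mul, Matrix.one_mul, Matrix.mul_assoc, Tt_mul_E_gram hR hE, Matrix.mul_zero, sub_zero]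
  · have e : M * B.toBlocks₁₁ = 1 - T * B.toBlocks₂₁ := eq_sub_of_add_eq r11
    rw [Matrix.mul_assoc, e, Matrix.mul_sub, Matrix.mul_one, ← Matrix.mul_assoc, E_mul_T_gram hR hE, Matrix.zero_mul, sub_zero]

end Gram

/-! ## §4 (v1.1) The KKT form with a general comb `τ` (`τ·τᵀ` invertible), `E := fromBlocks (1 − τᵀ(ττᵀ)⁻¹τ) 0 0 1` -/

section KKTGram

variable {ν μ ρ : Type*} [Fintype ν] [Fintype μ] [Fintype ρ] [DecidableEq ν] [DecidableEq μ] [DecidableEq ρ]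
variable (K : Matrix ν ν 𝕜) (Q : Matrix μ ν 𝕜) (τ : Matrix ρ ν 𝕜)

/-- [folklore] For `T := [τᵀ; 0]`: `1 − T(TᵀT)⁻¹Tᵀ = fromBlocks (1 − τᵀ(ττᵀ)⁻¹τ) 0 0 1`. -/
theorem one_sub_fromRows_gram_transpose :
    (1 : Matrix (ν ⊕ μ) (ν ⊕ μ) 𝕜)
        - fromRows τᵀ (0 : Matrix μ ρ 𝕜) * ((fromRows τᵀ (0 : Matrix μ ρ 𝕜))ᵀ * fromRows τᵀ (0 : Matrix μ ρ 𝕜))⁻¹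
            * (fromRows τᵀ (0 : Matrix μ ρ 𝕜))ᵀ =
      fromBlocks (1 - τᵀ * (τ * τᵀ)⁻¹ * τ) 0 0 (1 : Matrix μ μ 𝕜) := by
  rw [transpose_fromRows_mul_fromRows, transpose_fromRows, transpose_transpose, transpose_zero, fromRows_mul, fromRows_mul_fromCols,
    Matrix.zero_mul, Matrix.zero_mul, Matrix.zero_mul, Matrix.mul_zero, ← fromBlocks_one, sub_eq_add_neg, fromBlocks_neg, fromBlocks_add]
  simp only [neg_zero, add_zero, ← sub_eq_add_neg]

/-- [folklore] **KKT FORM, GENERAL COMB: THE RELATIVE RULES MAKE `kkt K (fromRows Q τ)` INVERTIBLE** (`τ·τᵀ` invertible; `E·A = A`, `E·(kkt K Q)·A = E`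
for `E := fromBlocks (1 − τᵀ(ττᵀ)⁻¹τ) 0 0 1`). -/
theorem isUnit_det_kkt_fromRows_of_relInv_gram (hτ : IsUnit (τ * τᵀ).det) {A : Matrix (ν ⊕ μ) (ν ⊕ μ) 𝕜}
    (hEA : fromBlocks (1 - τᵀ * (τ * τᵀ)⁻¹ * τ) 0 0 (1 : Matrix μ μ 𝕜) * A = A)
    (hEMA : fromBlocks (1 - τᵀ * (τ * τᵀ)⁻¹ * τ) 0 0 (1 : Matrix μ μ 𝕜) * kkt K Q * A
      = fromBlocks (1 - τᵀ * (τ * τᵀ)⁻¹ * τ) 0 0 (1 : Matrix μ μ 𝕜)) :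
    IsUnit (kkt K (fromRows Q τ)).det := by
  have hR : IsUnit ((fromRows τᵀ (0 : Matrix μ ρ 𝕜))ᵀ * fromRows τᵀ (0 : Matrix μ ρ 𝕜)).det := by
    rwa [transpose_fromRows_mul_fromRows]
  have hE := (one_sub_fromRows_gram_transpose (μ := μ) τ).symm
  have h := isUnit_det_combBordered_gram (M := kkt K Q) hR hE hEA hEMA
  rwa [← kkt_fromRows_submatrix_sumAssoc, det_submatrix_equiv_self] at h

/-- [folklore] **KKT FORM, GENERAL COMB: THE `(ν ⊕ μ)`-BLOCKS OF `(kkt K (fromRows Q τ))⁻¹` ARE THE RELATIVE INVERSE `A`**: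
`flucCov K (fromRows Q τ) = A₁₁`, `(minOp …).toCols₁ = A₁₂`, `(minOpL …).toRows₁ = A₂₁`, `(effForm …).toBlocks₁₁ = −A₂₂`. -/
theorem blocks_kkt_fromRows_of_relInv_gram (hτ : IsUnit (τ * τᵀ).det) {A : Matrix (ν ⊕ μ) (ν ⊕ μ) 𝕜}
    (hEA : fromBlocks (1 - τᵀ * (τ * τᵀ)⁻¹ * τ) 0 0 (1 : Matrix μ μ 𝕜) * A = A)
    (hEMA : fromBlocks (1 - τᵀ * (τ * τᵀ)⁻¹ * τ) 0 0 (1 : Matrix μ μ 𝕜) * kkt K Q * A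
      = fromBlocks (1 - τᵀ * (τ * τᵀ)⁻¹ * τ) 0 0 (1 : Matrix μ μ 𝕜)) :
    flucCov K (fromRows Q τ) = A.toBlocks₁₁ ∧ (minOp K (fromRows Q τ)).toCols₁ = A.toBlocks₁₂ ∧
      (minOpL K (fromRows Q τ)).toRows₁ = A.toBlocks₂₁ ∧ (effForm K (fromRows Q τ)).toBlocks₁₁ = -A.toBlocks₂₂ := by
  have hR : IsUnit ((fromRows τᵀ (0 : Matrix μ ρ 𝕜))ᵀ * fromRows τᵀ (0 : Matrix μ ρ 𝕜)).det := by
    rwa [transpose_fromRows_mul_fromRows]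
  have hE := (one_sub_fromRows_gram_transpose (μ := μ) τ).symm
  have hinv := toBlocks₁₁_inv_combBordered_gram (M := kkt K Q) hR hE hEA hEMA
  rw [← kkt_fromRows_submatrix_sumAssoc, inv_submatrix_equiv] at hinv
  have e : ∀ a b : ν ⊕ μ, (kkt K (fromRows Q τ))⁻¹ (Equiv.sumAssoc ν μ ρ (Sum.inl a)) (Equiv.sumAssoc ν μ ρ (Sum.inl b)) = A a b := by
    intro a b
    have := congr_fun (congr_fun hinv a) b
    exact this
  refine ⟨?_, ?_, ?_, ?_⟩
  · ext i i'
    have := e (Sum.inl i) (Sum.inl i')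
    simp only [Equiv.sumAssoc_apply_inl_inl] at this
    exact this
  · ext i j'
    have := e (Sum.inl i) (Sum.inr j')
    simp only [Equiv.sumAssoc_apply_inl_inl, Equiv.sumAssoc_apply_inl_inr] at this
    exact this
  · ext j i'
    have := e (Sum.inr j) (Sum.inl i')
    simp only [Equiv.sumAssoc_apply_inl_inl, Equiv.sumAssoc_apply_inl_inr] at this
    exact this
  · ext j j'
    have := e (Sum.inr j) (Sum.inr j')
    simp only [Equiv.sumAssoc_apply_inl_inr] at this
    change -((kkt K (fromRows Q τ))⁻¹ (Sum.inr (Sum.inl j)) (Sum.inr (Sum.inl j'))) = -(A (Sum.inr j) (Sum.inr j'))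
    rw [this]

/-- [folklore] **CONVERSE IN KKT FORM, GENERAL COMB**: if `τ·τᵀ` is invertible and `kkt K (fromRows Q τ)` is invertible, the pack of its
`(ν ⊕ μ)`-blocks satisfies the four rules w.r.t. `kkt K Q` and `E := fromBlocks (1 − τᵀ(ττᵀ)⁻¹τ) 0 0 1`. -/
theorem relInv_blocks_kkt_fromRows_gram (hτ : IsUnit (τ * τᵀ).det) (h : IsUnit (kkt K (fromRows Q τ)).det) :
    let A : Matrix (ν ⊕ μ) (ν ⊕ μ) 𝕜 := fromBlocks (flucCov K (fromRows Q τ)) (minOp K (fromRows Q τ)).toCols₁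
      (minOpL K (fromRows Q τ)).toRows₁ (-(effForm K (fromRows Q τ)).toBlocks₁₁)
    let E : Matrix (ν ⊕ μ) (ν ⊕ μ) 𝕜 := fromBlocks (1 - τᵀ * (τ * τᵀ)⁻¹ * τ) 0 0 (1 : Matrix μ μ 𝕜)
    E * A = A ∧ A * E = A ∧ A * kkt K Q * E = E ∧ E * kkt K Q * A = E := by
  intro A E
  have hR : IsUnit ((fromRows τᵀ (0 : Matrix μ ρ 𝕜))ᵀ * fromRows τᵀ (0 : Matrix μ ρ 𝕜)).det := by
    rwa [transpose_fromRows_mul_fromRows]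
  have hE : E = 1 - fromRows τᵀ (0 : Matrix μ ρ 𝕜) * ((fromRows τᵀ (0 : Matrix μ ρ 𝕜))ᵀ * fromRows τᵀ (0 : Matrix μ ρ 𝕜))⁻¹
      * (fromRows τᵀ (0 : Matrix μ ρ 𝕜))ᵀ := (one_sub_fromRows_gram_transpose (μ := μ) τ).symm
  have h' : IsUnit (fromBlocks (kkt K Q) (fromRows τᵀ (0 : Matrix μ ρ 𝕜)) (fromRows τᵀ (0 : Matrix μ ρ 𝕜))ᵀ 0).det := by
    rwa [← kkt_fromRows_submatrix_sumAssoc, det_submatrix_equiv_self]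
  have hA : A = ((fromBlocks (kkt K Q) (fromRows τᵀ (0 : Matrix μ ρ 𝕜)) (fromRows τᵀ (0 : Matrix μ ρ 𝕜))ᵀ 0)⁻¹).toBlocks₁₁ := by
    rw [← kkt_fromRows_submatrix_sumAssoc, inv_submatrix_equiv]
    ext a b
    rcases a with i | j <;> rcases b with i' | j'
    · rfl
    · rfl
    · rfl
    · change -(-((kkt K (fromRows Q τ))⁻¹ (Sum.inr (Sum.inl j)) (Sum.inr (Sum.inl j')))) =
        (kkt K (fromRows Q τ))⁻¹ (Sum.inr (Sum.inl j)) (Sum.inr (Sum.inl j'))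
      rw [neg_neg]
  clear_value A E
  rw [hA]
  exact relInv_of_isUnit_det_combBordered_gram hR hE h'

end KKTGram

end Summit.QuantumFields.BalabanUV.Beta.RelInvCombBorderedKKTGram
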